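import Summits.ResolutionOfSingularities.ResolutionOfSingularities.Theorems.EquisingularLiftEquisingularLiftNatELNatAtQuadrics
import HarnessLib

/-!
# Every integral hypersurface of degree `≤ 2` in `ℙⁿ⁺¹_k̄`, every characteristic: a regular blow-up model (`EquisingularLift` residual currency)
# and EL♮ (`ELNatAt`, route currency of `EquisingularLiftNat`)

[OURS · leafhand-res-equisingularlift-6 g3, 2026-08-31; cell `pub/decomp-res`; items stmt-ResolutionOfSingularities-15660 / -20038 / -20148] AI-produced, weaker
than expert review; NOT a statement of any manuscript; nothing here proves resolution of singularities.  DEF-FREE; no `sorry`; standard axioms; ZERO named hypotheses.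

Book-keeping around ✓ `StrataSplit.blowupModel_of_range_eq_quadric` (p818836) and ✓ `QuadricELNat.elNatAt_quadric` (p820083): the prime forms of degree `≤ 2` are the
prime LINEAR forms (hyperplanes `≅ ℙⁿ`, smooth) and the prime QUADRATIC forms (done); a form of degree `0` is a constant, never prime.

* `isNonsingularForm_of_isHomogeneous_one` — a non-zero linear form is a nonsingular form (some `∂ⱼL` is a non-zero constant);
* `not_prime_of_isHomogeneous_zero` — a form of degree `0` is not prime;
* ★ `blowupModel_of_range_eq_of_degree_le_two` — every `(H, ι)` of the crux binder (`ι : H ↪ ℙⁿ⁺¹_k̄` closed immersion, `H` integral) with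
  `range ι = V₊(F)`, `F` PRIME of degree `e ≤ 2`, has `𝔞 ≠ ⊥` with all blow-ups regular — every `n`, every `p`;
* ★ `elNatAt_of_range_eq_of_degree_le_two` — the same `(H, ι)` (`n ≥ 1`) satisfy `Theorems.EquisingularLift.ELNatAt p k (n + 1) H ι` — every `p`.

Honest reading: closes no registered stub; the residuals start at prime forms of degree `3`.
-/

set_option linter.dupNamespace false -- mandated namespace `Summit.<Summit>.<Problem>` of this single-conjunct summit

noncomputable section

open CategoryTheory CategoryTheory.Limits AlgebraicGeometry TopologicalSpace
open MvPolynomial HomogeneousIdeal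
open Literature.AlgebraicGeometry.Resolution Literature.AlgebraicGeometry.Motives
open Literature.AlgebraicGeometry.Motives.SmoothHypersurface
open Literature.AlgebraicGeometry.Motives.ProjectiveSpaceCells
open Summit.ResolutionOfSingularities.ResolutionOfSingularities.Theorems.EquisingularLift
open Summit.ResolutionOfSingularities.ResolutionOfSingularities.Cruxes.EquisingularLift.StrataSplit

namespace Summit.ResolutionOfSingularities.ResolutionOfSingularities.Cruxes.EquisingularLiftNat.Sections

namespace QuadricELNat

variable {k : Type} [Field k] {n : ℕ}

/-- The partial derivative of a linear form `Σ vₗ xₗ` is the constant `vⱼ`. [folklore] -/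
theorem pderiv_lin (v : Fin (n + 1 + 1) → k) (j : Fin (n + 1 + 1)) :
    pderiv j (lin v) = C (v j) := by
  classical
  simp only [lin, map_sum]
  rw [Finset.sum_eq_single j (fun l _ hl => by
      rw [smul_eq_C_mul, Derivation.leibniz, pderiv_C, pderiv_X, Pi.single_eq_of_ne' hl.symm]; simp)
    (fun h => absurd (Finset.mem_univ j) h)]
  rw [smul_eq_C_mul, Derivation.leibniz, pderiv_C, pderiv_X, Pi.single_eq_same]
  simp

/-- **A non-zero linear form is a nonsingular form**: one of its partial derivatives is a non-zero constant, a unit in any prime containing it.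
[cite: Hartshorne1977, I Ex. 5.8] -/
theorem isNonsingularForm_of_isHomogeneous_one {L : MvPolynomial (Fin (n + 1 + 1)) k} (hL : L.IsHomogeneous 1) (hL0 : L ≠ 0) :
    IsNonsingularForm k L := by
  classical
  intro 𝔭 h𝔭 _ hder i
  obtain ⟨j, hj⟩ : ∃ j, coeff (Finsupp.single j 1) L ≠ 0 := by
    by_contra h
    push Not at h
    apply hL0
    rw [eq_lin_of_isHomogeneous_one hL]
    simp [lin, h]
  have hd : pderiv j L = C (coeff (Finsupp.single j 1) L) := by
    conv_lhs => rw [eq_lin_of_isHomogeneous_one hL]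
    exact pderiv_lin _ j
  have hunit : IsUnit (pderiv j L) := by
    rw [hd]
    exact (IsUnit.mk0 _ hj).map C
  exact absurd (𝔭.eq_top_of_isUnit_mem (hder j) hunit) h𝔭.ne_top

/-- A form of degree `0` is a constant, hence not prime. [folklore] -/
theorem not_prime_of_isHomogeneous_zero {F : MvPolynomial (Fin (n + 1 + 1)) k} (hF : F.IsHomogeneous 0) : ¬Prime F := by
  intro hprime
  rw [← totalDegree_zero_iff_isHomogeneous, totalDegree_eq_zero_iff_eq_C] at hF
  by_cases hc : coeff 0 F = 0
  · exact hprime.ne_zero (by rw [hF, hc, map_zero])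
  · exact hprime.not_unit (by rw [hF]; exact (IsUnit.mk0 _ hc).map C)

/-- ★ **Every integral hypersurface of degree `≤ 2` has a regular blow-up model, every characteristic**: for `(H, ι)` of the crux binder with
`range ι = V₊(F)`, `F` prime of degree `e ≤ 2` — hyperplanes (✓ `blowupModel_of_range_eq_of_isNonsingularForm`) and quadrics
(✓ `blowupModel_of_range_eq_quadric`). [OURS · DEF-FREE] [cite: Hartshorne1977, I Ex. 5.12 and II Ex. 7.12] -/
theorem blowupModel_of_range_eq_of_degree_le_two [IsAlgClosed k]
    {H : Scheme.{0}} (ιH : H ⟶ (projectiveSpace (n + 1) k).left) [IsClosedImmersion ιH] [IsIntegral H]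
    (F : MvPolynomial (Fin (n + 1 + 1)) k) {e : ℕ} (hF : F.IsHomogeneous e) (he : e ≤ 2) (hprime : Prime F)
    (hrange : letI := MvPolynomial.gradedAlgebra (σ := Fin (n + 1 + 1)) (R := k)
      Set.range ιH = {x : Proj (homogeneousSubmodule (Fin (n + 1 + 1)) k) | F ∈ x.asHomogeneousIdeal}) :
    ∃ 𝔞 : H.IdealSheafData, 𝔞 ≠ ⊥ ∧ ∀ (Z : Scheme.{0}) (π : Z ⟶ H), IsBlowup π 𝔞 → Scheme.IsRegular Z := by
  interval_cases e
  · exact absurd hprime (not_prime_of_isHomogeneous_zero hF)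
  · exact blowupModel_of_range_eq_of_isNonsingularForm ιH F hF one_pos hprime
      (isNonsingularForm_of_isHomogeneous_one hF hprime.ne_zero) hrange
  · exact blowupModel_of_range_eq_quadric ιH F hF hprime hrange

/-- ★ **EL♮ for every integral hypersurface of degree `≤ 2` in `ℙⁿ⁺¹_k̄`, `n ≥ 1`, every characteristic**: for a closed immersion `ι : H ⟶ ℙⁿ⁺¹_k` with
`range ι = V₊(F)`, `F` prime of degree `e ≤ 2`: `ELNatAt p k (n + 1) H ι` — hyperplanes (✓ `HypersurfaceSpecimen.elNatAt_smoothHypersurface` +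
✓ `LinAutTransport.elNatAt_of_range_eq`) and quadrics (✓ `elNatAt_quadric`). [OURS · DEF-FREE] [cite: Hartshorne1977, I Ex. 5.12] -/
theorem elNatAt_of_range_eq_of_degree_le_two (p : ℕ) (hp : p.Prime) (k : Type) [Field k] [CharP k p] [IsAlgClosed k] {n : ℕ} (hn : 1 ≤ n)
    {H : Scheme.{0}} (ι : H ⟶ (projectiveSpace (n + 1) k).left) [IsClosedImmersion ι]
    (F : MvPolynomial (Fin (n + 1 + 1)) k) {e : ℕ} (hF : F.IsHomogeneous e) (he : e ≤ 2) (hprime : Prime F)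
    (hrange : letI := MvPolynomial.gradedAlgebra (σ := Fin (n + 1 + 1)) (R := k)
      Set.range ι = {x : Proj (homogeneousSubmodule (Fin (n + 1 + 1)) k) | F ∈ x.asHomogeneousIdeal}) :
    ELNatAt p k (n + 1) H ι := by
  interval_cases e
  · exact absurd hprime (not_prime_of_isHomogeneous_zero hF)
  · letI := MvPolynomial.gradedAlgebra (σ := Fin (n + 1 + 1)) (R := k)
    have hrange' : Set.range ι = {x : (projectiveSpace (n + 1) k).left | F ∈ x.asHomogeneousIdeal} := hrange
    refine LinAutTransport.elNatAt_of_range_eq p k (n + 1) _ (hypersurfaceι F).left ?_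
      (HypersurfaceSpecimen.elNatAt_smoothHypersurface p hp k hn F hF le_rfl
        (isNonsingularForm_of_isHomogeneous_one hF hprime.ne_zero))
    rw [hrange', setOf_mem_eq_range_hypersurfaceι]
  · exact elNatAt_quadric p hp k ι F hF hprime hrange

end QuadricELNat

end Summit.ResolutionOfSingularities.ResolutionOfSingularities.Cruxes.EquisingularLiftNat.Sections

end
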